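import Summits.ResolutionOfSingularities.ResolutionOfSingularities.Theorems.RadicialJungCleanModelsStubCossartPiltant2019OfLeavesClosed
import HarnessLib

/-!
# `CleanModels`, stub 2 (F-02) BY ITS TYPE from PRINTED STATEMENTS ONLY: {CP 2019 Thm. 1.5, stub 1 (CJS Thm. 1.4),
# [CoP1] Lemma 9.4 (totally ramified Kummer core), [CoP1] Prop. 9.3, Hironaka 1964 (char. 0 only)}

OURS (decomp-res hand-1 g20; crux `stmt-ResolutionOfSingularities-15917`, skeleton rev 35
`Cruxes/CleanModels/Lines/Sketch.lean`, stub `stub_cossartPiltant2019 : CossartPiltant2019.{0}`). A BOOKKEEPING file continuing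
`RadicialJungCleanModelsStubCossartPiltant2019{Leaves,LeavesRankOne,LeavesCharP,LeavesQuotientLU,LeavesClosed,OfLeavesClosed}.lean`.

Hand-1 g19 closed the leaf list of stub 2 at characteristic `p` down to {`CossartPiltant2019Local` (printed), stub 1 (printed),
`hEqT`, `hEqI`}, where `hEqT` / `hEqI` are EQUIVARIANT local-uniformization statements (a local uniformization whose local ring is
stable under a finite group fixing the valuation) — the statements the printed PROOFS of [CoP1] Lemma 9.4 ("`S` is stable by `G`,
since any conjugate of `S` is dominated by `W`, hence equal to `S`", HAL hal-00139124 p. 29 l. 16 — false as a general sentence,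
hand-1 g19 memo (F5)) and of [CoP1] Prop. 9.3 (the invariant ring `(S₀ⁱ)^{Gˢ/Gⁱ}`, HAL p. 27) silently use; neither is a statement
found in print.  This file re-keys the same conclusion on the two printed STATEMENTS instead, using the tree's chain
`cossartPiltant2019ReductionP_of_emb_of_kummer` (`Literature/…/ArithmeticalThreefoldsLocalDescentEmbChain1.lean`):

* `hKummer` — **[CoP1] Lemma 9.4 in its hard case** (`s = f = pᵈ = 1`, `e = ℓ`): for a totally ramified Kummer step
  `A(θ) | A` of prime degree `ℓ ≠ p` with `ζ_ℓ ∈ A` (inertia group `= ⊤`), a local uniformization of the rank-one valuation on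
  `A(θ)` gives one on `A` ("pushing down local uniformization in tamely ramified extensions", Problem 9.1's tame case);
* `hUnram` — **[CoP1] Prop. 9.3**: for `M ≤ K′ ≤ Mⁱ` (`Mⁱ` the inertia field of a finite Galois `N | M`), a local
  uniformization of the valuation on `K′` gives one on `M`.

Both are verbatim the hypotheses of `cossartPiltant2019ReductionP_of_emb_of_kummer`; principalization
(`CossartPiltant2019Principalization_holds`) and CJS Cor. 1.5 (`CossartJannsenSaito2020Embedded.cor15`, from stub 1) are proved
in the tree and discharged here.  Results:

* `cossartPiltant2019ReductionP_of_stub1_of_kummer_of_unram` — `CossartPiltant2019ReductionP.{0}` from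
  {`CossartPiltant2019Local`, stub 1, `hKummer`, `hUnram`};
* `localUniformization3_of_stub1_of_kummer_of_unram_charP` / `resolutionOverUpToDim_three_of_stub1_of_kummer_of_unram_charP` —
  the `k`-instance of F-02 at characteristic `p` from the same four leaves;
* `cossartPiltant2019_of_stub1_of_kummer_of_unram_of_hironaka` — **the TYPE of stub 2, `CossartPiltant2019.{0}`, from
  {`CossartPiltant2019Local.{0}`, `CossartJannsenSaito2020Embedded.{0}`, `hKummer`, `hUnram`, `Hironaka1964_local.{0}`}** —
  five PRINTED STATEMENTS (CP 2019 Thm. 1.5 · CJS 2020 Thm. 1.4 · [CoP1] Lemma 9.4 · [CoP1] Prop. 9.3 · Hironaka 1964 /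
  Temkin 2008), the last used only at characteristic `0`.

Honest framing: the printed proofs of [CoP1] Lemma 9.4 and Prop. 9.3 each contain an unjustified stability step (hand-1 g10–g19;
counterexample to the Lemma 9.4 sentence in `Cruxes/CleanModels/Lines/Sketch-memo-hand1-g19.md` (F5)); re-keying on the printed
STATEMENTS does not repair those proofs, it only separates «what is claimed in print» from «what the printed proofs would need».
Nothing here proves resolution of singularities in positive characteristic, local uniformization in dimension three, or any
statement of a manuscript under adjudication; rung 0. AI-written; AI review weaker than expert review.
-/

-- `Summit.<Summit>.<Sub>.Theorems` with `Sub = Summit` (single-conjunct summit, D-0017)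
set_option linter.dupNamespace false

noncomputable section

open IsLocalRing Polynomial AlgebraicGeometry
open _root_.IntermediateField
open Literature.AlgebraicGeometry.Resolution
open Summit.ResolutionOfSingularities.ResolutionOfSingularities.Theorems.CP2008Prop44

namespace Summit.ResolutionOfSingularities.ResolutionOfSingularities.Theorems.RadicialJung.CleanModels

/-- **`CossartPiltant2019ReductionP` from `CossartPiltant2019Local` (CP 2019 Thm. 1.5), stub 1 (CJS Thm. 1.4, `B = ∅`), and the
printed statements [CoP1] Lemma 9.4 (totally ramified Kummer core, `hKummer`) and [CoP1] Prop. 9.3 (`hUnram`).**  The tree's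
`cossartPiltant2019ReductionP_of_emb_of_kummer` with principalization (`CossartPiltant2019Principalization_holds`) and the embedded
resolution of surfaces in CJS Cor. 1.5 shape (`CossartJannsenSaito2020Embedded.cor15`) discharged.
[cite: CossartPiltant2019, Thm. 1.5, Props. 4.3, 4.4 and proof of Prop. 4.10 (arXiv v1: Props. 4.2, 4.3, 4.8, pp. 50–54)]
[cite: CossartPiltant2008, Lemma 9.4, Prop. 9.3, Prop. 9.5 (HAL hal-00139124 pp. 26–30)]
[cite: CossartJannsenSaito2020, Thm. 1.4, Cor. 1.5] -/
theorem cossartPiltant2019ReductionP_of_stub1_of_kummer_of_unram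
    (hloc : CossartPiltant2019Local.{0}) (hCJSE : CossartJannsenSaito2020Embedded.{0})
    (hKummer :
      ∀ (p : ℕ), p.Prime →
      ∀ (S : Type) [CommRing S] [IsDomain S] [IsRegularLocalRing S],
        IsExcellentRing S → ringKrullDim S = 3 → CharP (ResidueField S) p →
        IsAdicComplete (maximalIdeal S) S →
      ∀ (E : Type) [Field E] [Algebra S E], Function.Injective (algebraMap S E) →
        IsAlgClosed E → Algebra.IsAlgebraic S E →
      ∀ (OE : ValuationSubring E), (∀ s : S, algebraMap S E s ∈ OE) →
        (∀ s ∈ maximalIdeal S, OE.valuation (algebraMap S E s) < 1) →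
        (∀ y : OE, ∃ q : S[X], (∃ i, q.coeff i ∉ maximalIdeal S) ∧
          OE.valuation (q.eval₂ (algebraMap S E) y) < 1) →
      Nonempty OE.valuation.RankOne →
      ∀ (ℓ : ℕ), ℓ.Prime → ℓ ≠ p → ∀ (ζ : E), IsPrimitiveRoot ζ ℓ →
      ∀ (A : Subfield E), (∀ s : S, algebraMap S E s ∈ A) → ζ ∈ A →
      ∀ (θ : E), θ ∉ A → θ ^ ℓ ∈ A → OE.valuation θ ≤ 1 →
        Module.finrank A (adjoin A ({θ} : Set E)) = ℓ → IsGalois A (adjoin A ({θ} : Set E)) →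
        inertiaGroupIn OE (adjoin A ({θ} : Set E)) = ⊤ →
        (∃ t : Finset E, (t : Set E) ⊆ (adjoin A ({θ} : Set E)).toSubfield ∧
          (adjoin A ({θ} : Set E)).toSubfield ≤
            Subfield.closure (Set.range (algebraMap S E) ∪ (t : Set E)) ∧
          ∃ hTO : (Algebra.adjoin S (t : Set E)).toSubring ≤ OE.toSubring,
            IsRegularLocalRing (Localization.AtPrime
              (Ideal.comap (Subring.inclusion hTO) (maximalIdeal OE)))) →
        (∃ t : Finset E, (t : Set E) ⊆ A ∧
          A ≤ Subfield.closure (Set.range (algebraMap S E) ∪ (t : Set E)) ∧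
          ∃ hTO : (Algebra.adjoin S (t : Set E)).toSubring ≤ OE.toSubring,
            IsRegularLocalRing (Localization.AtPrime
              (Ideal.comap (Subring.inclusion hTO) (maximalIdeal OE)))))
    (hUnram :
      ∀ (p : ℕ), p.Prime →
      ∀ (S : Type) [CommRing S] [IsDomain S] [IsRegularLocalRing S],
        IsExcellentRing S → ringKrullDim S = 3 → CharP (ResidueField S) p →
        IsAdicComplete (maximalIdeal S) S →
      ∀ (E : Type) [Field E] [Algebra S E], Function.Injective (algebraMap S E) →
        IsAlgClosed E → Algebra.IsAlgebraic S E →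
      ∀ (OE : ValuationSubring E), (∀ s : S, algebraMap S E s ∈ OE) →
        (∀ s ∈ maximalIdeal S, OE.valuation (algebraMap S E s) < 1) →
        (∀ y : OE, ∃ q : S[X], (∃ i, q.coeff i ∉ maximalIdeal S) ∧
          OE.valuation (q.eval₂ (algebraMap S E) y) < 1) →
      Nonempty OE.valuation.RankOne →
      ∀ (M : Subfield E), (∀ s : S, algebraMap S E s ∈ M) →
      ∀ (N : IntermediateField M E) [FiniteDimensional M N] [IsGalois M N] (K' : Subfield E),
        M ≤ K' → K' ≤ (lift (fixedField (inertiaGroupIn OE N))).toSubfield →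
        (∃ t : Finset E, (t : Set E) ⊆ K' ∧
          K' ≤ Subfield.closure (Set.range (algebraMap S E) ∪ (t : Set E)) ∧
          ∃ hTO : (Algebra.adjoin S (t : Set E)).toSubring ≤ OE.toSubring,
            IsRegularLocalRing (Localization.AtPrime
              (Ideal.comap (Subring.inclusion hTO) (maximalIdeal OE)))) →
        (∃ t : Finset E, (t : Set E) ⊆ M ∧
          M ≤ Subfield.closure (Set.range (algebraMap S E) ∪ (t : Set E)) ∧
          ∃ hTO : (Algebra.adjoin S (t : Set E)).toSubring ≤ OE.toSubring,
            IsRegularLocalRing (Localization.AtPrime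
              (Ideal.comap (Subring.inclusion hTO) (maximalIdeal OE))))) :
    CossartPiltant2019ReductionP.{0} :=
  cossartPiltant2019ReductionP_of_emb_of_kummer hloc CossartPiltant2019Principalization_holds hCJSE
    (CossartJannsenSaito2020Embedded.cor15 hCJSE) hKummer hUnram

/-- **`LocalUniformization3 k` (`CharP k p`, `p` prime) from the four printed leaves `CossartPiltant2019Local`, stub 1, [CoP1]
Lemma 9.4 (Kummer core, `hKummer`) and [CoP1] Prop. 9.3 (`hUnram`).**  `localUniformization3_of_stub1_of_reductionP_charP'` fed
with `cossartPiltant2019ReductionP_of_stub1_of_kummer_of_unram`.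
[cite: CossartPiltant2019, Thm. 1.5, Props. 4.4, 4.8 (with Lemma 4.7), 4.10] [cite: CossartPiltant2008, Prop. 8.1, Prop. 9.3, Lemma 9.4]
[cite: CossartJannsenSaito2020, Thm. 1.2, Thm. 1.4, Cor. 1.5] [cite: NovacoskiSpivakovsky2014, Thm. 1.1, Cor. 2.17, §3.1] -/
theorem localUniformization3_of_stub1_of_kummer_of_unram_charP (p : ℕ) (hp : p.Prime)
    (hloc : CossartPiltant2019Local.{0}) (hCJSE : CossartJannsenSaito2020Embedded.{0})
    (hKummer :
      ∀ (p : ℕ), p.Prime →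
      ∀ (S : Type) [CommRing S] [IsDomain S] [IsRegularLocalRing S],
        IsExcellentRing S → ringKrullDim S = 3 → CharP (ResidueField S) p →
        IsAdicComplete (maximalIdeal S) S →
      ∀ (E : Type) [Field E] [Algebra S E], Function.Injective (algebraMap S E) →
        IsAlgClosed E → Algebra.IsAlgebraic S E →
      ∀ (OE : ValuationSubring E), (∀ s : S, algebraMap S E s ∈ OE) →
        (∀ s ∈ maximalIdeal S, OE.valuation (algebraMap S E s) < 1) →
        (∀ y : OE, ∃ q : S[X], (∃ i, q.coeff i ∉ maximalIdeal S) ∧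
          OE.valuation (q.eval₂ (algebraMap S E) y) < 1) →
      Nonempty OE.valuation.RankOne →
      ∀ (ℓ : ℕ), ℓ.Prime → ℓ ≠ p → ∀ (ζ : E), IsPrimitiveRoot ζ ℓ →
      ∀ (A : Subfield E), (∀ s : S, algebraMap S E s ∈ A) → ζ ∈ A →
      ∀ (θ : E), θ ∉ A → θ ^ ℓ ∈ A → OE.valuation θ ≤ 1 →
        Module.finrank A (adjoin A ({θ} : Set E)) = ℓ → IsGalois A (adjoin A ({θ} : Set E)) →
        inertiaGroupIn OE (adjoin A ({θ} : Set E)) = ⊤ →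
        (∃ t : Finset E, (t : Set E) ⊆ (adjoin A ({θ} : Set E)).toSubfield ∧
          (adjoin A ({θ} : Set E)).toSubfield ≤
            Subfield.closure (Set.range (algebraMap S E) ∪ (t : Set E)) ∧
          ∃ hTO : (Algebra.adjoin S (t : Set E)).toSubring ≤ OE.toSubring,
            IsRegularLocalRing (Localization.AtPrime
              (Ideal.comap (Subring.inclusion hTO) (maximalIdeal OE)))) →
        (∃ t : Finset E, (t : Set E) ⊆ A ∧
          A ≤ Subfield.closure (Set.range (algebraMap S E) ∪ (t : Set E)) ∧
          ∃ hTO : (Algebra.adjoin S (t : Set E)).toSubring ≤ OE.toSubring,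
            IsRegularLocalRing (Localization.AtPrime
              (Ideal.comap (Subring.inclusion hTO) (maximalIdeal OE)))))
    (hUnram :
      ∀ (p : ℕ), p.Prime →
      ∀ (S : Type) [CommRing S] [IsDomain S] [IsRegularLocalRing S],
        IsExcellentRing S → ringKrullDim S = 3 → CharP (ResidueField S) p →
        IsAdicComplete (maximalIdeal S) S →
      ∀ (E : Type) [Field E] [Algebra S E], Function.Injective (algebraMap S E) →
        IsAlgClosed E → Algebra.IsAlgebraic S E →
      ∀ (OE : ValuationSubring E), (∀ s : S, algebraMap S E s ∈ OE) →
        (∀ s ∈ maximalIdeal S, OE.valuation (algebraMap S E s) < 1) →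
        (∀ y : OE, ∃ q : S[X], (∃ i, q.coeff i ∉ maximalIdeal S) ∧
          OE.valuation (q.eval₂ (algebraMap S E) y) < 1) →
      Nonempty OE.valuation.RankOne →
      ∀ (M : Subfield E), (∀ s : S, algebraMap S E s ∈ M) →
      ∀ (N : IntermediateField M E) [FiniteDimensional M N] [IsGalois M N] (K' : Subfield E),
        M ≤ K' → K' ≤ (lift (fixedField (inertiaGroupIn OE N))).toSubfield →
        (∃ t : Finset E, (t : Set E) ⊆ K' ∧
          K' ≤ Subfield.closure (Set.range (algebraMap S E) ∪ (t : Set E)) ∧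
          ∃ hTO : (Algebra.adjoin S (t : Set E)).toSubring ≤ OE.toSubring,
            IsRegularLocalRing (Localization.AtPrime
              (Ideal.comap (Subring.inclusion hTO) (maximalIdeal OE)))) →
        (∃ t : Finset E, (t : Set E) ⊆ M ∧
          M ≤ Subfield.closure (Set.range (algebraMap S E) ∪ (t : Set E)) ∧
          ∃ hTO : (Algebra.adjoin S (t : Set E)).toSubring ≤ OE.toSubring,
            IsRegularLocalRing (Localization.AtPrime
              (Ideal.comap (Subring.inclusion hTO) (maximalIdeal OE)))))
    (k : Type) [Field k] [CharP k p] : LocalUniformization3 k :=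
  localUniformization3_of_stub1_of_reductionP_charP' p hp hloc
    (cossartPiltant2019ReductionP_of_stub1_of_kummer_of_unram hloc hCJSE hKummer hUnram) hCJSE k

/-- **`ResolutionOverUpToDim k 3` (`CharP k p`, `p` prime: the `k`-instance of F-02) from the four printed leaves
`CossartPiltant2019Local`, stub 1, [CoP1] Lemma 9.4 (Kummer core) and [CoP1] Prop. 9.3**, by the proved patching
(`CossartPiltant2019Patching_holds`). [cite: CossartPiltant2019, Thm. 1.1, Thm. 1.5, Props. 4.6, 4.8, 4.10]
[cite: CossartPiltant2008, Prop. 9.3, Lemma 9.4] [cite: CossartJannsenSaito2020, Thm. 1.2, Thm. 1.4] -/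
theorem resolutionOverUpToDim_three_of_stub1_of_kummer_of_unram_charP (p : ℕ) (hp : p.Prime)
    (hloc : CossartPiltant2019Local.{0}) (hCJSE : CossartJannsenSaito2020Embedded.{0})
    (hKummer :
      ∀ (p : ℕ), p.Prime →
      ∀ (S : Type) [CommRing S] [IsDomain S] [IsRegularLocalRing S],
        IsExcellentRing S → ringKrullDim S = 3 → CharP (ResidueField S) p →
        IsAdicComplete (maximalIdeal S) S →
      ∀ (E : Type) [Field E] [Algebra S E], Function.Injective (algebraMap S E) →
        IsAlgClosed E → Algebra.IsAlgebraic S E →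
      ∀ (OE : ValuationSubring E), (∀ s : S, algebraMap S E s ∈ OE) →
        (∀ s ∈ maximalIdeal S, OE.valuation (algebraMap S E s) < 1) →
        (∀ y : OE, ∃ q : S[X], (∃ i, q.coeff i ∉ maximalIdeal S) ∧
          OE.valuation (q.eval₂ (algebraMap S E) y) < 1) →
      Nonempty OE.valuation.RankOne →
      ∀ (ℓ : ℕ), ℓ.Prime → ℓ ≠ p → ∀ (ζ : E), IsPrimitiveRoot ζ ℓ →
      ∀ (A : Subfield E), (∀ s : S, algebraMap S E s ∈ A) → ζ ∈ A →
      ∀ (θ : E), θ ∉ A → θ ^ ℓ ∈ A → OE.valuation θ ≤ 1 →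
        Module.finrank A (adjoin A ({θ} : Set E)) = ℓ → IsGalois A (adjoin A ({θ} : Set E)) →
        inertiaGroupIn OE (adjoin A ({θ} : Set E)) = ⊤ →
        (∃ t : Finset E, (t : Set E) ⊆ (adjoin A ({θ} : Set E)).toSubfield ∧
          (adjoin A ({θ} : Set E)).toSubfield ≤
            Subfield.closure (Set.range (algebraMap S E) ∪ (t : Set E)) ∧
          ∃ hTO : (Algebra.adjoin S (t : Set E)).toSubring ≤ OE.toSubring,
            IsRegularLocalRing (Localization.AtPrime
              (Ideal.comap (Subring.inclusion hTO) (maximalIdeal OE)))) →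
        (∃ t : Finset E, (t : Set E) ⊆ A ∧
          A ≤ Subfield.closure (Set.range (algebraMap S E) ∪ (t : Set E)) ∧
          ∃ hTO : (Algebra.adjoin S (t : Set E)).toSubring ≤ OE.toSubring,
            IsRegularLocalRing (Localization.AtPrime
              (Ideal.comap (Subring.inclusion hTO) (maximalIdeal OE)))))
    (hUnram :
      ∀ (p : ℕ), p.Prime →
      ∀ (S : Type) [CommRing S] [IsDomain S] [IsRegularLocalRing S],
        IsExcellentRing S → ringKrullDim S = 3 → CharP (ResidueField S) p →
        IsAdicComplete (maximalIdeal S) S →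
      ∀ (E : Type) [Field E] [Algebra S E], Function.Injective (algebraMap S E) →
        IsAlgClosed E → Algebra.IsAlgebraic S E →
      ∀ (OE : ValuationSubring E), (∀ s : S, algebraMap S E s ∈ OE) →
        (∀ s ∈ maximalIdeal S, OE.valuation (algebraMap S E s) < 1) →
        (∀ y : OE, ∃ q : S[X], (∃ i, q.coeff i ∉ maximalIdeal S) ∧
          OE.valuation (q.eval₂ (algebraMap S E) y) < 1) →
      Nonempty OE.valuation.RankOne →
      ∀ (M : Subfield E), (∀ s : S, algebraMap S E s ∈ M) →
      ∀ (N : IntermediateField M E) [FiniteDimensional M N] [IsGalois M N] (K' : Subfield E),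
        M ≤ K' → K' ≤ (lift (fixedField (inertiaGroupIn OE N))).toSubfield →
        (∃ t : Finset E, (t : Set E) ⊆ K' ∧
          K' ≤ Subfield.closure (Set.range (algebraMap S E) ∪ (t : Set E)) ∧
          ∃ hTO : (Algebra.adjoin S (t : Set E)).toSubring ≤ OE.toSubring,
            IsRegularLocalRing (Localization.AtPrime
              (Ideal.comap (Subring.inclusion hTO) (maximalIdeal OE)))) →
        (∃ t : Finset E, (t : Set E) ⊆ M ∧
          M ≤ Subfield.closure (Set.range (algebraMap S E) ∪ (t : Set E)) ∧
          ∃ hTO : (Algebra.adjoin S (t : Set E)).toSubring ≤ OE.toSubring,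
            IsRegularLocalRing (Localization.AtPrime
              (Ideal.comap (Subring.inclusion hTO) (maximalIdeal OE)))))
    (k : Type) [Field k] [CharP k p] : ResolutionOverUpToDim.{0} k 3 :=
  resolutionOverUpToDim_three_of_stub1_of_reductionP_charP' p hp hloc
    (cossartPiltant2019ReductionP_of_stub1_of_kummer_of_unram hloc hCJSE hKummer hUnram) hCJSE k

/-- **The TYPE of stub 2, `CossartPiltant2019.{0}`, from five PRINTED STATEMENTS: `CossartPiltant2019Local.{0}` (CP 2019
Thm. 1.5), `CossartJannsenSaito2020Embedded.{0}` (CJS Thm. 1.4 = the type of stub 1), [CoP1] Lemma 9.4 in its totally ramified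
Kummer case (`hKummer`), [CoP1] Prop. 9.3 (`hUnram`), and `Hironaka1964_local.{0}` (used only at characteristic `0`).**
Proof: for a field `k` of characteristic `p`, (LU) for complete three-dimensional local domains of residue characteristic `p` is
`cossartPiltant2019ReductionP_of_stub1_of_kummer_of_unram` (`p` prime) or `Hironaka1964_local.cpLocalUniformization_of_isAdicComplete`
(`p = 0`); then `localUniformization3_of_stub1_of_luComplete3` and the proved patching — the proof of
`cossartPiltant2019_of_stub1_of_equivariantLU_of_hironaka` (hand-1 g19) with the research leaves `hEqT`, `hEqI` replaced by the
printed statements they were introduced to prove.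
[cite: CossartPiltant2019, Thm. 1.1, Thm. 1.5, Props. 4.4, 4.6, 4.8, 4.10] [cite: CossartPiltant2008, Prop. 9.3, Lemma 9.4, Prop. 9.5]
[cite: CossartJannsenSaito2020, Thm. 1.2, Thm. 1.4, Cor. 1.5] [cite: Temkin2008, Thm. 1.1] [cite: NovacoskiSpivakovsky2014, Thm. 1.1, Cor. 2.17, §3.1] -/
theorem cossartPiltant2019_of_stub1_of_kummer_of_unram_of_hironaka
    (hloc : CossartPiltant2019Local.{0}) (hCJSE : CossartJannsenSaito2020Embedded.{0})
    (hKummer :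
      ∀ (p : ℕ), p.Prime →
      ∀ (S : Type) [CommRing S] [IsDomain S] [IsRegularLocalRing S],
        IsExcellentRing S → ringKrullDim S = 3 → CharP (ResidueField S) p →
        IsAdicComplete (maximalIdeal S) S →
      ∀ (E : Type) [Field E] [Algebra S E], Function.Injective (algebraMap S E) →
        IsAlgClosed E → Algebra.IsAlgebraic S E →
      ∀ (OE : ValuationSubring E), (∀ s : S, algebraMap S E s ∈ OE) →
        (∀ s ∈ maximalIdeal S, OE.valuation (algebraMap S E s) < 1) →
        (∀ y : OE, ∃ q : S[X], (∃ i, q.coeff i ∉ maximalIdeal S) ∧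
          OE.valuation (q.eval₂ (algebraMap S E) y) < 1) →
      Nonempty OE.valuation.RankOne →
      ∀ (ℓ : ℕ), ℓ.Prime → ℓ ≠ p → ∀ (ζ : E), IsPrimitiveRoot ζ ℓ →
      ∀ (A : Subfield E), (∀ s : S, algebraMap S E s ∈ A) → ζ ∈ A →
      ∀ (θ : E), θ ∉ A → θ ^ ℓ ∈ A → OE.valuation θ ≤ 1 →
        Module.finrank A (adjoin A ({θ} : Set E)) = ℓ → IsGalois A (adjoin A ({θ} : Set E)) →
        inertiaGroupIn OE (adjoin A ({θ} : Set E)) = ⊤ →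
        (∃ t : Finset E, (t : Set E) ⊆ (adjoin A ({θ} : Set E)).toSubfield ∧
          (adjoin A ({θ} : Set E)).toSubfield ≤
            Subfield.closure (Set.range (algebraMap S E) ∪ (t : Set E)) ∧
          ∃ hTO : (Algebra.adjoin S (t : Set E)).toSubring ≤ OE.toSubring,
            IsRegularLocalRing (Localization.AtPrime
              (Ideal.comap (Subring.inclusion hTO) (maximalIdeal OE)))) →
        (∃ t : Finset E, (t : Set E) ⊆ A ∧
          A ≤ Subfield.closure (Set.range (algebraMap S E) ∪ (t : Set E)) ∧
          ∃ hTO : (Algebra.adjoin S (t : Set E)).toSubring ≤ OE.toSubring,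
            IsRegularLocalRing (Localization.AtPrime
              (Ideal.comap (Subring.inclusion hTO) (maximalIdeal OE)))))
    (hUnram :
      ∀ (p : ℕ), p.Prime →
      ∀ (S : Type) [CommRing S] [IsDomain S] [IsRegularLocalRing S],
        IsExcellentRing S → ringKrullDim S = 3 → CharP (ResidueField S) p →
        IsAdicComplete (maximalIdeal S) S →
      ∀ (E : Type) [Field E] [Algebra S E], Function.Injective (algebraMap S E) →
        IsAlgClosed E → Algebra.IsAlgebraic S E →
      ∀ (OE : ValuationSubring E), (∀ s : S, algebraMap S E s ∈ OE) →
        (∀ s ∈ maximalIdeal S, OE.valuation (algebraMap S E s) < 1) →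
        (∀ y : OE, ∃ q : S[X], (∃ i, q.coeff i ∉ maximalIdeal S) ∧
          OE.valuation (q.eval₂ (algebraMap S E) y) < 1) →
      Nonempty OE.valuation.RankOne →
      ∀ (M : Subfield E), (∀ s : S, algebraMap S E s ∈ M) →
      ∀ (N : IntermediateField M E) [FiniteDimensional M N] [IsGalois M N] (K' : Subfield E),
        M ≤ K' → K' ≤ (lift (fixedField (inertiaGroupIn OE N))).toSubfield →
        (∃ t : Finset E, (t : Set E) ⊆ K' ∧
          K' ≤ Subfield.closure (Set.range (algebraMap S E) ∪ (t : Set E)) ∧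
          ∃ hTO : (Algebra.adjoin S (t : Set E)).toSubring ≤ OE.toSubring,
            IsRegularLocalRing (Localization.AtPrime
              (Ideal.comap (Subring.inclusion hTO) (maximalIdeal OE)))) →
        (∃ t : Finset E, (t : Set E) ⊆ M ∧
          M ≤ Subfield.closure (Set.range (algebraMap S E) ∪ (t : Set E)) ∧
          ∃ hTO : (Algebra.adjoin S (t : Set E)).toSubring ≤ OE.toSubring,
            IsRegularLocalRing (Localization.AtPrime
              (Ideal.comap (Subring.inclusion hTO) (maximalIdeal OE)))))
    (hH : Hironaka1964_local.{0}) : CossartPiltant2019.{0} := by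
  intro k _ X f hsep hlft hqc hred hdim
  obtain ⟨p, hp⟩ := CharP.exists k
  have hLU3 : ∀ (A : Type) [CommRing A] [IsDomain A] [IsLocalRing A] [IsNoetherianRing A]
      [IsAdicComplete (maximalIdeal A) A],
      ringKrullDim A = 3 → CharP (ResidueField A) p → CPLocalUniformization A := by
    intro A _ _ _ _ _ hdimA hchar
    rcases CharP.char_is_prime_or_zero k p with hprime | h0
    · exact cossartPiltant2019ReductionP_of_stub1_of_kummer_of_unram hloc hCJSE hKummer hUnram hloc p
        hprime A hdimA hchar
    · subst h0
      haveI : CharZero (ResidueField A) := CharP.charP_to_charZero (ResidueField A)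
      exact hH.cpLocalUniformization_of_isAdicComplete A inferInstance
  exact CossartPiltant2019Patching_holds k (cossartJannsenSaito2020_of_embedded hCJSE k)
    (localUniformization3_of_stub1_of_luComplete3 p hCJSE hLU3 k) X f hsep hlft hqc hred hdim

end Summit.ResolutionOfSingularities.ResolutionOfSingularities.Theorems.RadicialJung.CleanModels

end
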